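import Mathlib
import Summits.ValiantsHypothesis.ValiantsHypothesis.Theorems.NewtonUnitEquationsDissociatedUniformTotalsLaw
import Summits.ValiantsHypothesis.ValiantsHypothesis.Theorems.NewtonUnitEquationsDissociatedUniformTotalsLawRankOne
import Summits.ValiantsHypothesis.ValiantsHypothesis.Theorems.NewtonUnitEquationsDissociatedUniformTotalsLawRankOneReduction
import Summits.ValiantsHypothesis.ValiantsHypothesis.Theorems.NewtonUnitEquationsDissociatedUniformTotalsLawRankOneCex
import Literature.Computability.AlgebraicComplexity.NewtonPolygonTauProductBounds
import HarnessLib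

/-!
# Crux `NewtonUnitEquations.DissociatedUniform` (stmt-ValiantsHypothesis-5905), `n = 3` totals law of model (Q**):
# the rank-one stratum — CONVERSE of the reduction: every envelope instance is sector 1 of a rank-one class, so
# `RankOnePointwise C → EnvelopeBound C`

Companion of `…TotalsLawRankOne` / `…TotalsLawRankOneReduction` (`classVert_rankOne_le : V_s ≤ Σ_{k≤6} envPieces (instₖ)`,
`envelopeBound_imp_rankOnePointwise : EnvelopeBound C → RankOnePointwise (6C)`).  THIS FILE closes the loop:
* `envPieces_inst₁_le_classVert` — the south-west exposed points of instance 1 are hull vertices of the class (transport back along the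
  involution `L₁`, weight `(τ, 1-τ)`), so `envPieces (inst₁) ≤ V_s`;
* `envPieces_le_classVert_rankOne` — every (ENV) instance `(φ, ψ, c)` IS instance 1 of the class `s = 0` of the rank-one configuration
  `α = -φ`, `β = -ψ`, `γ z = -c (-z)`; hence **`rankOnePointwise_imp_envelopeBound : RankOnePointwise C → EnvelopeBound C`**.
So the two located conjectures are equivalent up to the constant (`EnvelopeBound C → RankOnePointwise (6C) → EnvelopeBound (6C)`), and the
kernel certificates of `…RankOneCex` / `…RankOneCex10` transfer: `not_rankOnePointwise_two : ¬ RankOnePointwise 2`.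
Honest label: bookkeeping; `EnvelopeBound`, `RankOnePointwise`, `TotalsLawThree` remain OPEN; VP ≠ VNP is not touched.
[folklore: strict maximisers of a linear functional on a finite planar set are hull vertices]
-/

set_option linter.dupNamespace false -- `ValiantsHypothesis.ValiantsHypothesis` (summit = problem) in every name

open Matrix Finset

namespace Summit.ValiantsHypothesis.ValiantsHypothesis.Theorems.NewtonUnitEquationsDissociatedUniform

namespace TotalsLaw

open Literature.Computability.AlgebraicComplexity.KPTT.PlanarMinkowski

section Converse

variable {G : Type*} [AddCommGroup G] [Fintype G]
variable (α β γ : G → ℝ) (s : G)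

/-- `L₁` is an involution. [folklore] -/
theorem L₁_L₁ (p : Fin 2 → ℝ) : L₁ (L₁ p) = p := by
  ext i; fin_cases i <;> simp [L₁]

/-- A south-west exposed point of `L₁(F)` pulls back to a hull vertex of `F`. [folklore] -/
theorem mem_extremePoints_of_isSWExposed_image {F : Finset (Fin 2 → ℝ)} {p : Fin 2 → ℝ}
    (h : IsSWExposed (F.image L₁) (L₁ p)) : p ∈ (convexHull ℝ (F : Set (Fin 2 → ℝ))).extremePoints ℝ := by
  classical
  obtain ⟨τ, -, -, hτ⟩ := h
  -- transport back along `L₁` with the weight `(τ, 1 - τ)`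
  have himg : (F.image L₁).image L₁ = F := by
    rw [Finset.image_image]
    convert Finset.image_id (s := F) using 2
    funext q
    exact L₁_L₁ q
  have hst : IsStrictTop ![τ, 1 - τ] ((F.image L₁).image L₁) (L₁ (L₁ p)) :=
    isStrictTop_image_of_compat hτ L₁ one_pos fun q => by
      rw [vec2_dot, vec2_dot]
      simp only [L₁, cons_val_zero, cons_val_one]
      ring
  rw [himg, L₁_L₁] at hst
  exact hst.mem_extremePoints

/-- **`envPieces (inst₁) ≤ V_s`**: instance 1's exposed points are class vertices. -/
theorem envPieces_inst₁_le_classVert :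
    envPieces₃ (inst₁ α β γ s) ≤ classVert (rankOneA α) (rankOneB β) (rankOneC γ) s := by
  classical
  unfold envPieces₃ envPieces swCount
  rw [envPts_inst₁]
  set F := rkFin α β γ s with hF
  unfold classVert
  rw [← coe_rkFin]
  -- the exposed points of `F.image L₁`, pulled back by `L₁`, are distinct hull vertices of `F`
  have hfin : ((convexHull ℝ (F : Set (Fin 2 → ℝ))).extremePoints ℝ).Finite :=
    F.finite_toSet.subset extremePoints_convexHull_subset
  have hsub : ((F.image L₁).filter (IsSWExposed (F.image L₁))).image L₁ ⊆ hfin.toFinset := by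
    intro q hq
    obtain ⟨y, hy, rfl⟩ := Finset.mem_image.1 hq
    rw [Finset.mem_filter] at hy
    obtain ⟨p, -, rfl⟩ := Finset.mem_image.1 hy.1
    rw [L₁_L₁, Set.Finite.mem_toFinset]
    exact mem_extremePoints_of_isSWExposed_image hy.2
  calc ((F.image L₁).filter (IsSWExposed (F.image L₁))).card
      = (((F.image L₁).filter (IsSWExposed (F.image L₁))).image L₁).card :=
        (Finset.card_image_of_injective _ L₁_injective).symm
    _ ≤ hfin.toFinset.card := Finset.card_le_card hsub
    _ = ((convexHull ℝ (F : Set (Fin 2 → ℝ))).extremePoints ℝ).ncard := (Set.ncard_eq_toFinset_card _ hfin).symm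

/-- **Every (ENV) instance is instance 1 of a rank-one class**: for `φ ψ c : G → ℝ`,
`envPieces φ ψ c ≤ V_0` of the rank-one configuration `α = -φ`, `β = -ψ`, `γ z = -c (-z)`. -/
theorem envPieces_le_classVert_rankOne (φ ψ c : G → ℝ) :
    envPieces φ ψ c ≤
      classVert (rankOneA fun x => -φ x) (rankOneB fun y => -ψ y) (rankOneC fun z => -c (-z)) 0 := by
  have h := envPieces_inst₁_le_classVert (fun x => -φ x) (fun y => -ψ y) (fun z => -c (-z)) (0 : G)
  have e : inst₁ (fun x => -φ x) (fun y => -ψ y) (fun z => -c (-z)) (0 : G) = (φ, ψ, c) := by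
    unfold inst₁
    simp only [neg_neg, zero_sub]
  unfold envPieces₃ at h
  rw [e] at h
  exact h

end Converse

/-- **`RankOnePointwise C → EnvelopeBound C`** (with `envelopeBound_imp_rankOnePointwise`: the two located conjectures are equivalent
up to the constant). -/
theorem rankOnePointwise_imp_envelopeBound {C : ℕ} (h : RankOnePointwise C) : EnvelopeBound C := by
  intro G _ _ φ ψ c
  exact (envPieces_le_classVert_rankOne φ ψ c).trans (h G _ _ _ 0)

/-- Hence the `ℤ/4` certificate of `…RankOneCex` transfers: **`¬ RankOnePointwise 2`** (some rank-one class has more than `2|G|`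
vertices). -/
theorem not_rankOnePointwise_two : ¬ RankOnePointwise 2 :=
  fun h => EnvCex4.not_envelopeBound_two (rankOnePointwise_imp_envelopeBound h)

end TotalsLaw

end Summit.ValiantsHypothesis.ValiantsHypothesis.Theorems.NewtonUnitEquationsDissociatedUniform
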